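import Summits.Ventures.Crystal3D.Theorems.StickyWulffConstantGenericWallFloorDoubleTopLocalCert
import HarnessLib

/-!
# Stars-only double stars, local part 1: the star support of a rigidity certificate
# (crux `GenericWallFloor`, line `WallLedgerG`; input `StarPairCoaxial` of the localised stack ledger)

HONEST FRAMING. Part of the venture `Summits/Ventures/Crystal3D` (cell `crystal3d-full`), helper
`--supports` the crux `GenericWallFloor` (stmt-Ventures-19480) of `route-Ventures-StickyWulffConstant`,
registered line `WallLedgerG`, open stub `stub_twoSlabAdhesion`.  The localised stack ledger (19480-p2 g3) prices
coincident walk ends through `DoubleStarCoaxialAt` (R39d) and `CapPairCoaxial` (R39e); both follow from the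
stars-only input `StarPairCoaxial` (`…GenericWallFloorStarPairCoaxial`).  Its certificate (lit g13, exact rationals:
HOME/cf-lit/r41e/star/) re-uses wulff-p2's certificate FORMAT `DTCert` (`…DoubleTopLocalCert`) with multipliers
SUPPORTED ON THE STAR: the five cluster indices `starIdx = {0, 5, 6, 9, 10}` — the predecessor `(−1,−1,0)` and
the four slots `(0,−1,±1)`, `(−1,0,±1)` (× `√2`), i.e. the closed vertex star of `−slotSite 0` at the top.

* `starIdx`, `DTCert.StarSupported` (decidable): contact-pair multipliers only on `starIdx × starIdx`,
  coincidence multipliers only for moving star balls coinciding with a FIXED STAR ball, cage multipliers only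
  on star balls.
The soundness on the support (`DTCert.sound_star`) is `…StarPairLocalSound`; the 46 records are
`…StarPairLocalData1–4`.

WHAT THIS IS NOT: no certificate, no soundness, not the stub; rung F-C1 not moved.
-/

namespace Summit.Ventures.Crystal3D.Theorems.NearIdentity

/-- The STAR indices of the walk cluster: `clusterInt 0 = (−1,−1,0)` (the predecessor) and
`clusterInt 5, 6, 9, 10 = (0,−1,1), (0,−1,−1), (−1,0,1), (−1,0,−1)` — the five contacts of the top `0` in the
closed vertex star of `−slotSite 0`. -/
def starIdx : Finset (Fin 13) := {0, 5, 6, 9, 10}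

/-- Table check: the star balls are exactly the cluster balls `w` with `⟪w, slotSite 0⟫ < 0` that touch the top
(`|w|² = 2` in the `× √2` frame), i.e. `dotQ (clusterQ i) (clusterQ i) = 2`. -/
theorem mem_starIdx_iff_norm (i : Fin 13) : i ∈ starIdx ↔ dotQ (clusterQ i) (clusterQ i) = 2 := by
  revert i; decide +kernel

namespace DTCert

variable (C : DTCert)

/-- The certificate's multipliers are SUPPORTED ON THE STAR: contact pairs `(i, j)` with both indices in
`starIdx`; coincidence forms only for moving balls `j ∈ starIdx` coinciding with a fixed STAR ball; fixed and
moving cage balls in `starIdx`. -/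
def StarSupported : Prop :=
  (∀ s w l i j, C.lamJ s w l i j ≠ 0 → i ∈ starIdx ∧ j ∈ starIdx) ∧
  (∀ s w l j m, C.lamC s w l j m ≠ 0 → j ∈ starIdx ∧ ∃ i ∈ starIdx, clusterQ i = C.Q j) ∧
  (∀ s w l i, C.lamF s w l i ≠ 0 → i ∈ starIdx) ∧
  (∀ s w l j, C.lamM s w l j ≠ 0 → j ∈ starIdx)

/-- `StarSupported` is decidable (the data files use `decide +kernel`). -/
instance : Decidable C.StarSupported := by unfold StarSupported; infer_instance

end DTCert

end Summit.Ventures.Crystal3D.Theorems.NearIdentity
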